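import Summits.ValiantsHypothesis.ValiantsHypothesis.Theorems.MonotoneRestorationOrbitRestorationQPAltFixEigen
import HarnessLib

/-!
# Small `Sym_n`-modules have alternating-fixed vectors, III: the theorem

Route MonotoneRestoration, crux `OrbitRestorationQP` (stmt-ValiantsHypothesis-18293), line `depth-three-rung`,
stub A_∞ `stub_sigmaPiSigmaValue`, ΣΛΣ sub-rung.  See `…AltFixBlocks.lean` for the overview.

This file: the elementary growth arithmetic (`poly_lt_pow_succ`, `poly_lt_two_pow`, `support_le`:
`2^w ≤ n^c + c` and `C(n/3, w) ≤ n^c + c` force `w ≤ c` for `n ≥ n₀(c)`) and the theorem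

* `altFix` — **for every `c` there is `n₀` such that for `n ≥ n₀`, every nonzero finite-dimensional complex
  representation of `Perm (Fin n)` of dimension `≤ n^c + c` has a nonzero vector fixed by every EVEN
  permutation fixing pointwise a set of at most `3c` points.**

Everything is proved (no Specht modules, no character theory). [folklore]
-/

noncomputable section

open scoped Classical

-- `Summit.ValiantsHypothesis.ValiantsHypothesis.…` is the tree's single-conjunct layout (Sub = Summit).
set_option linter.dupNamespace false

namespace Summit.ValiantsHypothesis.ValiantsHypothesis.Theorems

namespace AltFix

open Equiv Equiv.Perm Module Module.End

/-! ### Growth arithmetic -/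

/-- `A (q+1)^c + B < q^(c+1)` for `q` large. [folklore] -/
theorem poly_lt_pow_succ (c A B : ℕ) : ∃ q₀ : ℕ, ∀ q : ℕ, q₀ ≤ q → A * (q + 1) ^ c + B < q ^ (c + 1) := by
  refine ⟨2 ^ c * A + B + 1, fun q hq => ?_⟩
  have hq1 : 1 ≤ q := by omega
  have h1 : (q + 1) ^ c ≤ (2 * q) ^ c := Nat.pow_le_pow_left (by omega) c
  have h2 : (2 * q) ^ c = 2 ^ c * q ^ c := mul_pow 2 q c
  have h3 : 1 ≤ q ^ c := Nat.one_le_pow _ _ hq1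
  calc A * (q + 1) ^ c + B ≤ A * (2 ^ c * q ^ c) + B * q ^ c :=
        add_le_add (by rw [← h2]; exact Nat.mul_le_mul_left _ h1) (Nat.le_mul_of_pos_right _ h3)
    _ = (2 ^ c * A + B) * q ^ c := by ring
    _ < (2 ^ c * A + B + 1) * q ^ c := by nlinarith
    _ ≤ q * q ^ c := Nat.mul_le_mul_right _ hq
    _ = q ^ (c + 1) := by ring

/-- `A (q+1)^c + B < 2^q` for `q` large (exponential beats polynomial, via `2^q ≥ C(q, c+2)`). [folklore] -/
theorem poly_lt_two_pow (c A B : ℕ) : ∃ q₀ : ℕ, ∀ q : ℕ, q₀ ≤ q → A * (q + 1) ^ c + B < 2 ^ q := by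
  obtain ⟨q₁, hq₁⟩ := poly_lt_pow_succ (c + 1) ((c + 2).factorial * A * (c + 3) ^ c) ((c + 2).factorial * B)
  refine ⟨q₁ + c + 2, fun q hq => ?_⟩
  obtain ⟨q', rfl⟩ : ∃ q', q = q' + (c + 2) := ⟨q - (c + 2), by omega⟩
  have hq' : q₁ ≤ q' := by omega
  -- `2^q ≥ C(q, c+2) ≥ (q'+1)^(c+2) / (c+2)!`
  have hchoose : (q' + (c + 2)).choose (c + 2) ≤ 2 ^ (q' + (c + 2)) := by
    rw [← Nat.sum_range_choose]
    exact Finset.single_le_sum (f := fun k => (q' + (c + 2)).choose k) (fun _ _ => Nat.zero_le _)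
      (Finset.mem_range.2 (by omega))
  have hdesc : (q' + 1) ^ (c + 2) ≤ (c + 2).factorial * (q' + (c + 2)).choose (c + 2) := by
    rw [← Nat.descFactorial_eq_factorial_mul_choose]
    have := Nat.pow_sub_le_descFactorial (q' + (c + 2)) (c + 2)
    rwa [show q' + (c + 2) + 1 - (c + 2) = q' + 1 by omega] at this
  -- the polynomial side
  have hbase : q' + (c + 2) + 1 ≤ (c + 3) * (q' + 1) := by nlinarith
  have hpow : (q' + (c + 2) + 1) ^ c ≤ (c + 3) ^ c * (q' + 1) ^ c := by
    rw [← mul_pow]; exact Nat.pow_le_pow_left hbase c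
  have hpow' : (q' + 1) ^ c ≤ (q' + 1) ^ (c + 1) := Nat.pow_le_pow_right (by omega) (by omega)
  have hmain := hq₁ q' hq'
  have hq'pow : q' ^ (c + 1 + 1) ≤ (q' + 1) ^ (c + 2) := Nat.pow_le_pow_left (by omega) _
  have hfac : 0 < (c + 2).factorial := Nat.factorial_pos _
  -- assemble: `(c+2)! * (A (q+1)^c + B) < (c+2)! * 2^q`
  have key : (c + 2).factorial * (A * (q' + (c + 2) + 1) ^ c + B) < (c + 2).factorial * 2 ^ (q' + (c + 2)) := by
    calc (c + 2).factorial * (A * (q' + (c + 2) + 1) ^ c + B)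
        ≤ (c + 2).factorial * (A * ((c + 3) ^ c * (q' + 1) ^ (c + 1)) + B) := by
          apply Nat.mul_le_mul_left
          apply Nat.add_le_add_right
          apply Nat.mul_le_mul_left
          exact hpow.trans (Nat.mul_le_mul_left _ hpow')
      _ = (c + 2).factorial * A * (c + 3) ^ c * (q' + 1) ^ (c + 1) + (c + 2).factorial * B := by ring
      _ < q' ^ (c + 1 + 1) := hmain
      _ ≤ (q' + 1) ^ (c + 2) := hq'pow
      _ ≤ (c + 2).factorial * (q' + (c + 2)).choose (c + 2) := hdesc
      _ ≤ (c + 2).factorial * 2 ^ (q' + (c + 2)) := Nat.mul_le_mul_left _ hchoose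
  exact Nat.lt_of_mul_lt_mul_left key

/-- `C(m, ·)` is monotone below `m / 2`. [folklore] -/
theorem choose_mono_of_le_half (m a d : ℕ) (h : a + d ≤ m / 2) : m.choose a ≤ m.choose (a + d) := by
  induction d with
  | zero => simp
  | succ d ih =>
    calc m.choose a ≤ m.choose (a + d) := ih (by omega)
      _ ≤ m.choose (a + d + 1) := Nat.choose_le_succ_of_lt_half_left (by omega)
      _ = m.choose (a + (d + 1)) := by rw [Nat.add_assoc]

/-- **Support bound.**  For `n ≥ n₀(c)`: if `w ≤ n/3`, `2^w ≤ n^c + c` and `C(n/3, w) ≤ n^c + c` then `w ≤ c`.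
[folklore] -/
theorem support_le (c : ℕ) : ∃ n₀ : ℕ, ∀ n : ℕ, n₀ ≤ n → ∀ w : ℕ, w ≤ n / 3 →
    2 ^ w ≤ n ^ c + c → (n / 3).choose w ≤ n ^ c + c → w ≤ c := by
  obtain ⟨q₀, hq₀⟩ := poly_lt_two_pow c (6 ^ c) c
  obtain ⟨q₁, hq₁⟩ := poly_lt_pow_succ c ((c + 1).factorial * (3 * (c + 2)) ^ c) ((c + 1).factorial * c)
  refine ⟨6 * q₀ + 3 * q₁ + 3 * c + 12, fun n hn w hwm h2 hC => ?_⟩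
  by_contra hwc
  have hwc' : c + 1 ≤ w := by omega
  set m := n / 3 with hm
  have hn3 : n < 3 * (m + 1) := by omega
  by_cases hcase : w ≤ m / 2
  · -- polynomial case: `C(m, c+1) ≤ C(m, w) ≤ n^c + c` but `C(m, c+1)` is too big
    have hle : m.choose (c + 1) ≤ m.choose w := by
      have := choose_mono_of_le_half m (c + 1) (w - (c + 1)) (by omega)
      rwa [show c + 1 + (w - (c + 1)) = w by omega] at this
    have hdesc : (m + 1 - (c + 1)) ^ (c + 1) ≤ (c + 1).factorial * m.choose (c + 1) := by
      rw [← Nat.descFactorial_eq_factorial_mul_choose]; exact Nat.pow_sub_le_descFactorial m (c + 1)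
    obtain ⟨q, hq⟩ : ∃ q, m = q + (c + 1) := ⟨m - (c + 1), by omega⟩
    have hqq : q₁ ≤ q := by omega
    have hmain := hq₁ q hqq
    have hnle : n ≤ 3 * (c + 2) * (q + 1) := by nlinarith
    have hnpow : n ^ c ≤ (3 * (c + 2)) ^ c * (q + 1) ^ c := by
      rw [← mul_pow]; exact Nat.pow_le_pow_left hnle c
    have hfac : 0 < (c + 1).factorial := Nat.factorial_pos _
    have key : (c + 1).factorial * (n ^ c + c) < (c + 1).factorial * (n ^ c + c) := by
      calc (c + 1).factorial * (n ^ c + c)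
          ≤ (c + 1).factorial * ((3 * (c + 2)) ^ c * (q + 1) ^ c + c) :=
            Nat.mul_le_mul_left _ (Nat.add_le_add_right hnpow _)
        _ = (c + 1).factorial * (3 * (c + 2)) ^ c * (q + 1) ^ c + (c + 1).factorial * c := by ring
        _ < q ^ (c + 1) := hmain
        _ ≤ (q + 1) ^ (c + 1) := Nat.pow_le_pow_left (by omega) _
        _ = (m + 1 - (c + 1)) ^ (c + 1) := by rw [show m + 1 - (c + 1) = q + 1 by omega]
        _ ≤ (c + 1).factorial * m.choose (c + 1) := hdesc
        _ ≤ (c + 1).factorial * m.choose w := Nat.mul_le_mul_left _ hle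
        _ ≤ (c + 1).factorial * (n ^ c + c) := Nat.mul_le_mul_left _ hC
    exact lt_irrefl _ key
  · -- exponential case: `2^w ≥ 2^(m/2 + 1) > n^c + c`
    set q := m / 2 with hq
    have hwq : q + 1 ≤ w := by omega
    have hqq : q₀ ≤ q := by omega
    have hmain := hq₀ q hqq
    have hnle : n ≤ 6 * (q + 1) := by omega
    have hnpow : n ^ c ≤ 6 ^ c * (q + 1) ^ c := by
      rw [← mul_pow]; exact Nat.pow_le_pow_left hnle c
    have key : n ^ c + c < n ^ c + c := by
      calc n ^ c + c ≤ 6 ^ c * (q + 1) ^ c + c := Nat.add_le_add_right hnpow _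
        _ < 2 ^ q := hmain
        _ ≤ 2 ^ w := Nat.pow_le_pow_right (by norm_num) (by omega)
        _ ≤ n ^ c + c := h2
    exact lt_irrefl _ key

/-! ### The theorem -/

/-- **SMALL REPRESENTATIONS OF `Sym (Fin n)` HAVE ALTERNATING-FIXED VECTORS.**  For every `c` there is `n₀`
such that for all `n ≥ n₀`, every nonzero finite-dimensional complex representation
`ρ : Perm (Fin n) →* End ℂ V` with `finrank V ≤ n^c + c` has a nonzero vector fixed by every even
permutation fixing pointwise some set `Y` of at most `3c` points.  Proof: blocks of 3-cycles
(`exists_blockSystem`), a character `ε₀` of maximal support `N` among the nonzero joint eigenspaces, the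
counting bounds `2^|N|, C(n/3, |N|) ≤ finrank V` (`two_pow_card_support_le`, `choose_card_support_le`,
`card_filter_joint_ne_bot_le`) and `support_le` give `|N| ≤ c`; the partial eigenspace of the blocks in `N`
is stable under the pointwise stabiliser of those `3|N|` points and fixed by a spare 3-cycle
(`fixed_of_maxSupport`), hence by all even permutations fixing them (`fixed_of_threeCycle_fixed`). [folklore] -/
theorem altFix (c : ℕ) : ∃ n₀ : ℕ, ∀ n : ℕ, n₀ ≤ n →
    ∀ (V : Type) [AddCommGroup V] [Module ℂ V] [FiniteDimensional ℂ V] [Nontrivial V]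
      (ρ : Perm (Fin n) →* Module.End ℂ V), Module.finrank ℂ V ≤ n ^ c + c →
      ∃ Y : Finset (Fin n), Y.card ≤ 3 * c ∧ ∃ v : V, v ≠ 0 ∧
        ∀ g : Perm (Fin n), (∀ x ∈ Y, g x = x) → Perm.sign g = 1 → ρ g v = v := by
  obtain ⟨n₁, hn₁⟩ := support_le c
  refine ⟨n₁ + 3 * c + 3, fun n hn V _ _ _ _ ρ hdim => ?_⟩
  -- blocks of 3-cycles and a primitive cube root of unity
  have hm : 3 * (n / 3) ≤ n := Nat.mul_div_le n 3
  obtain ⟨b, γ, P, hb, hγ3c, hγ3, hγc, hγfix, hγcommfix, hflip, hflipc, hP⟩ := exists_blockSystem hm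
  obtain ⟨ω, hω⟩ : ∃ ω : ℂ, IsPrimitiveRoot ω 3 := ⟨_, Complex.isPrimitiveRoot_exp 3 (by norm_num)⟩
  -- the nonzero joint eigenspaces and a character of maximal support
  set E := Finset.univ.filter fun ε : Fin (n / 3) → ZMod 3 =>
    (⨅ i, eigenspace (ρ (γ i)) (ω ^ (ε i).val)) ≠ ⊥ with hE
  have htop : (⊤ : Submodule ℂ V) ≠ ⊥ := by
    obtain ⟨v, hv⟩ := exists_ne (0 : V)
    rw [Submodule.ne_bot_iff]; exact ⟨v, trivial, hv⟩
  have hEne : E.Nonempty := by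
    obtain ⟨ε, hε⟩ := exists_joint_inf_ne_bot ρ γ hω hγc hγ3 ⊤ htop (fun _ _ _ => trivial)
    refine ⟨ε, Finset.mem_filter.mpr ⟨Finset.mem_univ _, fun h => hε ?_⟩⟩
    rw [h, bot_inf_eq]
  obtain ⟨ε₀, hε₀E, hmax⟩ :=
    Finset.exists_max_image E (fun ε => (Finset.univ.filter fun i => ε i ≠ 0).card) hEne
  have hε₀ : (⨅ i, eigenspace (ρ (γ i)) (ω ^ (ε₀ i).val)) ≠ ⊥ := (Finset.mem_filter.mp hε₀E).2
  set N := Finset.univ.filter fun i => ε₀ i ≠ 0 with hN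
  -- the support is small
  have hEcard := card_filter_joint_ne_bot_le ρ γ hω hγc
  have h2 := two_pow_card_support_le ρ γ hω b hflip hflipc ε₀ hε₀
  have hC := choose_card_support_le ρ γ P hP ε₀ hε₀
  have hNm : N.card ≤ n / 3 :=
    (Finset.card_filter_le _ _).trans (by rw [Finset.card_univ, Fintype.card_fin])
  have hw : N.card ≤ c :=
    hn₁ n (by omega) N.card hNm (h2.trans (hEcard.trans hdim)) (hC.trans (hEcard.trans hdim))
  -- a spare block
  have hi₁ : ∃ i₁ : Fin (n / 3), i₁ ∉ N := by
    by_contra h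
    have hall : ∀ i, i ∈ N := fun i => by_contra fun hi => h ⟨i, hi⟩
    have : N.card = n / 3 := by
      rw [Finset.eq_univ_of_forall hall, Finset.card_univ, Fintype.card_fin]
    omega
  obtain ⟨i₁, hi₁⟩ := hi₁
  -- the witness: any nonzero vector of the joint eigenspace of `ε₀`
  obtain ⟨v, hv, hv0⟩ := (Submodule.ne_bot_iff _).mp hε₀
  have hvJ := (mem_joint_iff ρ γ _ _).mp hv
  let Y : Finset (Fin n) := (N ×ˢ (Finset.univ : Finset (Fin 3))).image fun p => b p.1 p.2
  have hYmem : ∀ i ∈ N, ∀ j, b i j ∈ Y := fun i hi j =>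
    Finset.mem_image.mpr ⟨(i, j), Finset.mem_product.mpr ⟨hi, Finset.mem_univ _⟩, rfl⟩
  have hYmem' : ∀ x ∈ Y, ∃ i ∈ N, ∃ j, x = b i j := by
    intro x hx
    obtain ⟨⟨i, j⟩, hp, rfl⟩ := Finset.mem_image.mp hx
    exact ⟨i, (Finset.mem_product.mp hp).1, j, rfl⟩
  refine ⟨Y, ?_, v, hv0, ?_⟩
  · calc Y.card ≤ (N ×ˢ (Finset.univ : Finset (Fin 3))).card := Finset.card_image_le
      _ = N.card * 3 := by rw [Finset.card_product, Finset.card_univ, Fintype.card_fin]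
      _ ≤ 3 * c := by omega
  · intro g hgY hsg
    refine fixed_of_threeCycle_fixed ρ {z | ∀ j ∈ N, ρ (γ j) z = ω ^ (ε₀ j).val • z} (↑Y : Set (Fin n))
      ?_ (γ i₁) (hγ3c i₁) ?_ ?_ g (fun x hx => hgY x (Finset.mem_coe.mp hx)) hsg v (fun j _ => hvJ j)
    · -- the partial eigenspace is stable under the pointwise stabiliser of `Y`
      intro g' hg' z hz j hj
      have hc := hγcommfix j g' fun j' => hg' _ (Finset.mem_coe.mpr (hYmem j hj j'))
      show ρ (γ j) (ρ g' z) = _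
      rw [← Module.End.mul_apply, ← map_mul, ← hc.eq, map_mul, Module.End.mul_apply, hz j hj, map_smul]
    · -- the spare 3-cycle fixes `Y` pointwise
      intro x hx
      obtain ⟨i, hiN, j, rfl⟩ := hYmem' x (Finset.mem_coe.mp hx)
      exact hγfix i₁ _ fun j' e => hi₁ ((hb _ _ _ _ e).1 ▸ hiN)
    · -- and fixes the partial eigenspace (key step)
      intro z hz
      exact fixed_of_maxSupport ρ γ hω hγc hγ3 ε₀ N (fun i => by simp [hN]) (fun ε hε => hmax ε
        (Finset.mem_filter.mpr ⟨Finset.mem_univ _, hε⟩)) hi₁ hz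

end AltFix

end Summit.ValiantsHypothesis.ValiantsHypothesis.Theorems

end
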